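import Summits.RiemannHypothesis.RiemannHypothesis.Theorems.TiltedLandingLaw421R3PerturbativeRung2
import Summits.RiemannHypothesis.RiemannHypothesis.Theorems.TiltedLandingLaw421R3ChildEnergyTwoLe
import Summits.RiemannHypothesis.RiemannHypothesis.Theorems.TiltedLandingLaw421R3LocatedPair
import Summits.RiemannHypothesis.RiemannHypothesis.Theorems.TiltedLandingLaw421R3PairCoherence

/-! # TiltedLandingLaw421R3LightPairDrop — K-2 REDUCED TO ONE f-FREE INEQUALITY: `GeometricBudget C μ₀ → PerturbativeDropLightPairQ C μ₀` (D4a) — W-08 C1 (rh-idea-5 g35)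

SUPPORT/COMPOSE module for crux `TiltedLandingLaw421R` ⟨stmt-RiemannHypothesis-33346⟩, route EarlyAppointments (`--supports … --as helper` only).  Imports
(all HELD tokens' targets): 37 `…R3PerturbativeRung2` (lens-2 3808089f: `LightPairAt`, `PerturbativeDropLightPairQ`), 34 `…R3ChildEnergyTwoLe` (C1 image C:
`childEnergyTwoLeQ_holds`), 38 `…R3LocatedPair` (C1 image E: `located_pair_of_lightAt`), C1 image F `…R3PairCoherence` (`newtonK_pair`, `norm_sub_le_of_hull`;
through it 35 `…R3PairSign`: `im_newtonK_le_of_atomicPair`).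
§1 `GeometricBudget C μ₀` — the f-FREE statement K-2 reduces to (C1 `D4-BUDGET-NOTE` §3 «budget»): for two points `0 < Im v < Im z` that touch
(`|Re v − Re z| ≤ Im v + Im z`) and are separated (`Im v ≤ 2‖v − z‖`), fields `K_v = (v−v̄)⁻¹ + (v−z)⁻¹ + (v−z̄)⁻¹ + R_v`, `K_z = (z−z̄)⁻¹ + (z−v)⁻¹ + (z−v̄)⁻¹ + R_z`
with `Im R_v ≤ 0`, `Im R_z ≤ 0` (the PAIR SIGNS, image D) and `‖R_z − R_v‖ ≤ M‖z − v‖/(Im v·Im z)` (the HULL COHERENCE, image F), `0 ≤ M ≤ μ₀`, floors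
`30 ≤ Im w·‖K_w + i/(2 Im w)‖`, and two points `u₁, u₂` in the sharp Newton discs `‖u_w − (w − K_w⁻¹)‖ ≤ (9/5)·(μ₀/(Im w‖K_w‖)²)/‖K_w‖` (image E):
`3 − C(1+μ₀)/(Im v·κ) ≤ ((Im v² + Im z²) − (Im u₁² + Im u₂²))·κ²`, `κ = ‖K_v + i/(2 Im v)‖`.  UNPROVED; a STATEMENT about nine complex/real numbers, no `f`;
model-scanned at `(C, μ₀) = (10, 1/2)` (note §2: min `(X − 3)·λ = −9.9 … −11.1 ≥ −15` over the 2-parameter family); fleet-native (region partition).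
§2 ★★ `perturbativeDropLightPairQ_of_budget (hμ : μ₀ ≤ 95) : GeometricBudget C μ₀ → PerturbativeDropLightPairQ C μ₀` — the COMPOSE (D4a): `BetaLevel` ↦ zeros,
touch, atomicity; `LightPairAt` ↦ one mass `M`, two light witnesses, (sep), the pair cofactor `g` with its hull clause; E ↦ the two located children (door
smallness from the floors: `Im w·‖K_w‖ ≥ λ_w − 1/2 ≥ 59/2`); C (34) ↦ `childEnergy(Ū) ≤ Im u₁² + Im u₂²`; F `newtonK_pair` ↦ the field decompositions with
`R_w = g′(w)/g(w)`; D ↦ `Im R_w ≤ 0`; F `norm_sub_le_of_hull` ↦ the drift bound; then the budget.  §2 also `perturbativeDropLightPairQ_ten_half`: the instance.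
What it is NOT: not a proof of K-2 (the budget is OPEN), not RUNG-P, not C′.  Nothing here bears on the truth of RH; RH is NOT proved; K-2 / RUNG-P / ★A /
33346 / 33347 OPEN; checked ≠ landed ≠ proved. -/

namespace RhW08.LightPairDrop

open Complex
open scoped ComplexConjugate
open RhW08.AntiEscapeSplit7 (newtonK)
open RhW08.UncoveredSign (pairPull im_pairField im_inv_sub_conj_self)
open RhW08.TouchedDissipation (Touches AtomicPair pairUnion childEnergy stateKappa)
open RhW08.PerturbativeRung (LightWitness LightAt)
open RhW08.PerturbativeRung2 (LightPairAt PerturbativeDropLightPairQ)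

/-! ## §1 The f-free budget statement -/

/-- §1 (STATEMENT, UNPROVED; C1 D4-BUDGET-NOTE §3 «budget») **THE GEOMETRIC BUDGET at `(C, μ₀)`** — see the module docstring.  Nine numbers, no frame,
no `f`: two touching separated points, their fields in pair form with the pair signs and the hull coherence, the floors, two points in the sharp Newton discs
⇒ the energy drop in `κ_v²` currency is at least `3 − C(1+μ₀)/λ_v`. -/
def GeometricBudget (C μ₀ : ℝ) : Prop :=
  ∀ (v z Rv Rz Kv Kz u₁ u₂ : ℂ) (M : ℝ),
    0 < v.im → v.im < z.im → |v.re - z.re| ≤ v.im + z.im → v.im ≤ 2 * ‖v - z‖ → 0 ≤ M → M ≤ μ₀ →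
    Kv = (v - conj v)⁻¹ + (v - z)⁻¹ + (v - conj z)⁻¹ + Rv → Kz = (z - conj z)⁻¹ + (z - v)⁻¹ + (z - conj v)⁻¹ + Rz →
    Rv.im ≤ 0 → Rz.im ≤ 0 → ‖Rz - Rv‖ ≤ M * ‖z - v‖ / (v.im * z.im) →
    30 ≤ v.im * ‖Kv + I / (2 * (v.im : ℂ))‖ → 30 ≤ z.im * ‖Kz + I / (2 * (z.im : ℂ))‖ →
    ‖u₁ - (v - Kv⁻¹)‖ ≤ (9 / 5) * (μ₀ / (v.im * ‖Kv‖) ^ 2) / ‖Kv‖ → ‖u₂ - (z - Kz⁻¹)‖ ≤ (9 / 5) * (μ₀ / (z.im * ‖Kz‖) ^ 2) / ‖Kz‖ →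
    3 - C * (1 + μ₀) / (v.im * ‖Kv + I / (2 * (v.im : ℂ))‖) ≤
      ((v.im ^ 2 + z.im ^ 2) - (u₁.im ^ 2 + u₂.im ^ 2)) * ‖Kv + I / (2 * (v.im : ℂ))‖ ^ 2

/-! ## §2 The compose -/

/-- §2 `Im v·‖K‖ ≥ Im v·‖K + i/(2 Im v)‖ − 1/2` (`‖i/(2 Im v)‖ = 1/(2 Im v)`): the `‖K‖`-currency floor from the `κ`-currency floor. -/
theorem im_mul_norm_ge {v K : ℂ} (hv : 0 < v.im) : v.im * ‖K + I / (2 * (v.im : ℂ))‖ - 1 / 2 ≤ v.im * ‖K‖ := by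
  have h1 : ‖K + I / (2 * (v.im : ℂ))‖ ≤ ‖K‖ + ‖I / (2 * (v.im : ℂ))‖ := norm_add_le _ _
  have h2 : ‖I / (2 * (v.im : ℂ))‖ = 1 / (2 * v.im) := by
    rw [norm_div, Complex.norm_I, norm_mul, RCLike.norm_ofNat, Complex.norm_real, Real.norm_eq_abs, abs_of_pos hv]
  rw [h2] at h1
  have h3 : v.im * ‖K + I / (2 * (v.im : ℂ))‖ ≤ v.im * ‖K‖ + v.im * (1 / (2 * v.im)) := by
    nlinarith [mul_le_mul_of_nonneg_left h1 hv.le]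
  have h4 : v.im * (1 / (2 * v.im)) = 1 / 2 := by field_simp
  linarith

/-- §2 the imaginary part of the three explicit pair terms at `w` against `p`: `Im((w−w̄)⁻¹ + (w−p)⁻¹ + (w−p̄)⁻¹) = −1/(2 Im w) + pairPull w p` (#1176). -/
theorem im_explicit (w p : ℂ) : ((w - conj w)⁻¹ + (w - p)⁻¹ + (w - conj p)⁻¹).im = -(1 / (2 * w.im)) + pairPull w p := by
  rw [add_assoc, add_im, im_inv_sub_conj_self, im_pairField]

/-- ★★ §2 **D4a — K-2 FROM THE GEOMETRIC BUDGET**: `μ₀ ≤ 95` (so the floors give E's door smallness) and `GeometricBudget C μ₀` ⇒ `PerturbativeDropLightPairQ C μ₀`. -/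
theorem perturbativeDropLightPairQ_of_budget {C μ₀ : ℝ} (hμ : μ₀ ≤ 95) (hGB : GeometricBudget C μ₀) : PerturbativeDropLightPairQ C μ₀ := by
  intro η f x₀ s hmax R Hs B hE j v z hβ hfl hL hflz
  have hβ' := hβ
  obtain ⟨-, -, hlow, ht, hat⟩ := hβ'
  have hFv : iteratedDeriv j f v = 0 := hlow.1.2.1
  have hv : 0 < v.im := hlow.1.2.2.1
  obtain ⟨hFz, hab, htouch⟩ := ht
  have hz : 0 < z.im := hv.trans hab
  have hvz : v ≠ z := fun e => by rw [e] at hab; exact lt_irrefl _ hab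
  obtain ⟨M, hMμ, hWv, hWz, hsep, g, hg, hfac, hhull⟩ := hL
  have hM0 : 0 ≤ M := hWv.2.1
  have hLv : LightAt μ₀ f j v := ⟨M, hMμ, hWv⟩
  have hLz : LightAt μ₀ f j z := ⟨M, hMμ, hWz⟩
  -- the floors in `‖K‖` currency and E's door smallness
  have hfl' : 30 ≤ v.im * ‖newtonK f j v + I / (2 * (v.im : ℂ))‖ := hfl
  have hflz' : 30 ≤ z.im * ‖newtonK f j z + I / (2 * (z.im : ℂ))‖ := hflz
  have hlamv : 59 / 2 ≤ v.im * ‖newtonK f j v‖ := by linarith [im_mul_norm_ge (K := newtonK f j v) hv]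
  have hlamz : 59 / 2 ≤ z.im * ‖newtonK f j z‖ := by linarith [im_mul_norm_ge (K := newtonK f j z) hz]
  have hdv : (9 / 2) * (1 + μ₀) ≤ (v.im * ‖newtonK f j v‖) ^ 2 / 2 := by nlinarith
  have hdz : (9 / 2) * (1 + μ₀) ≤ (z.im * ‖newtonK f j z‖) ^ 2 / 2 := by nlinarith
  -- E: the two located children; C (34): they majorise the child energy of `Ū`
  obtain ⟨hsv, hsz, -, hlamz3, u₁, u₂, hne, ⟨hd1, hG1, hD1, hS1⟩, ⟨hd2, hG2, hD2, hS2⟩⟩ :=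
    RhW08.LocatedPair.located_pair_of_lightAt hE hFv hFz hv hz hvz hLv hLz hdv hdz
  have hCE : childEnergy f j (pairUnion v z) ≤ u₁.im ^ 2 + u₂.im ^ 2 :=
    RhW08.PairWindowCompose.childEnergyTwoLeQ_holds η f x₀ s hmax R Hs B hE j v z hβ hfl hlamz3 u₁ u₂ hne hd1 hG1 hd2 hG2 hD1 hD2
  -- F: the pair form of the field at both points, `R_w = g′(w)/g(w)`
  have hgv : g v ≠ 0 := by simpa using (hhull 0 le_rfl zero_le_one).1
  have hgz : g z ≠ 0 := by simpa using (hhull 1 zero_le_one le_rfl).1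
  have hFv' : ∀ u : ℂ, iteratedDeriv j f u = (u - v) * ((u - conj v) * ((u - z) * ((u - conj z) * g u))) := fun u => by
    rw [hfac u]; ring
  have hFz' : ∀ u : ℂ, iteratedDeriv j f u = (u - z) * ((u - conj z) * ((u - v) * ((u - conj v) * g u))) := fun u => by
    rw [hfac u]; ring
  have hKv := RhW08.PairCoherence.newtonK_pair hv hz hvz hg.differentiableAt hgv hFv'
  have hKz := RhW08.PairCoherence.newtonK_pair hz hv hvz.symm hg.differentiableAt hgz hFz'
  -- D: the pair signs ⇒ `Im R_w ≤ 0`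
  obtain ⟨hsgv, hsgz⟩ := RhW08.PairSign.im_newtonK_le_of_atomicPair hE hFv hFz hv hz hvz hsv hsz hat
  have hRv : (deriv g v / g v).im ≤ 0 := by
    have e : (newtonK f j v).im = (-(1 / (2 * v.im)) + pairPull v z) + (deriv g v / g v).im := by
      rw [hKv, add_im, im_explicit]
    linarith
  have hRz : (deriv g z / g z).im ≤ 0 := by
    have e : (newtonK f j z).im = (-(1 / (2 * z.im)) + pairPull z v) + (deriv g z / g z).im := by
      rw [hKz, add_im, im_explicit]
    linarith
  -- F: the hull drift bound for `R = g′/g`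
  set Rg : ℂ → ℂ := fun w => deriv g w / g w with hRgdef
  have hR : ∀ t : ℝ, 0 ≤ t → t ≤ 1 →
      DifferentiableAt ℂ Rg (v + (t : ℂ) * (z - v)) ∧ (v + (t : ℂ) * (z - v)).im ^ 2 * ‖deriv Rg (v + (t : ℂ) * (z - v))‖ ≤ M := by
    intro t h0 h1
    obtain ⟨hne0, hbd⟩ := hhull t h0 h1
    exact ⟨((hg.analyticAt _).deriv.differentiableAt).div (hg _) hne0, hbd⟩
  have hdrift : ‖Rg z - Rg v‖ ≤ M * ‖z - v‖ / (v.im * z.im) := RhW08.PairCoherence.norm_sub_le_of_hull hv hab hR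
  -- the budget
  have hB := hGB v z (Rg v) (Rg z) (newtonK f j v) (newtonK f j z) u₁ u₂ M hv hab htouch hsep hM0 hMμ hKv hKz hRv hRz hdrift
    hfl' hflz' hS1 hS2
  have hκ : 0 ≤ ‖newtonK f j v + I / (2 * (v.im : ℂ))‖ ^ 2 := sq_nonneg _
  have hmono : ((v.im ^ 2 + z.im ^ 2) - (u₁.im ^ 2 + u₂.im ^ 2)) * ‖newtonK f j v + I / (2 * (v.im : ℂ))‖ ^ 2 ≤
      ((v.im ^ 2 + z.im ^ 2) - childEnergy f j (pairUnion v z)) * ‖newtonK f j v + I / (2 * (v.im : ℂ))‖ ^ 2 :=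
    mul_le_mul_of_nonneg_right (by linarith) hκ
  exact hB.trans hmono

/-- §2 the instance of record: `GeometricBudget 10 (1/2) → PerturbativeDropLightPairQ 10 (1/2)` (then lens-2's `rungP_of_pair_instance` needs only
`NearMassMonotonePairQ (1/2)` for RUNG-P). -/
theorem perturbativeDropLightPairQ_ten_half (hGB : GeometricBudget 10 (1 / 2)) : PerturbativeDropLightPairQ 10 (1 / 2) :=
  perturbativeDropLightPairQ_of_budget (by norm_num) hGB

end RhW08.LightPairDrop
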